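import Mathlib.Geometry.Manifold.MFDeriv.Atlas
import Literature.Topology.FourManifolds.HomotopyBallSlice
import Literature.Topology.FourManifolds.PalaisBallComplement
import Literature.Topology.FourManifolds.ConnectedSumData
import HarnessLib

/-!
# Slice knots are slice in a homotopy ball: discharge of `Knot.IsSmoothlySlice.isHomotopyBallSlice`

Topic `Literature/Topology/FourManifolds`; fact item `provefact-Literature.Knot.IsSmoothlySlice.isHomotopyBallSlice`
for the named fact `Literature.Topology.FourManifolds.Knot.IsSmoothlySlice.isHomotopyBallSlice` of `HomotopyBallSlice.lean`:

> `∀ K : Knot, K.IsSmoothlySlice → K.IsHomotopyBallSlice` — a knot bounding a smooth slice disc in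
> `B⁴` bounds a smooth proper disc in `Σ ∖ e(B̊⁴)` for some closed smooth 4-manifold `Σ ≃ₕ S⁴` and
> some smoothly embedded ball `e : ℝ⁴ ↪ Σ`.

This file proves it (`Literature.Topology.FourManifolds.Knot.IsSmoothlySlice.isHomotopyBallSlice_holds`) with `Σ = S⁴` itself;
it contains only theorems (the companion file `HomotopyBallSliceProofs.lean` discharges the other
fact of `HomotopyBallSlice.lean`, the FGMW lemma).

## Source and what it says

C. Manolescu, L. Piccirillo, *From zero surgeries to candidates for exotic definite 4-manifolds*,
J. Lond. Math. Soc. 108 (2023) = arXiv:2102.04391 (held), §2, the sentence after Definition 2.1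
(arXiv p. 4): "Observe that if a knot is slice in the usual sense, then it is H-slice in any
`W`." The vendored fact is the special case `W = Σ` a homotopy 4-sphere (with `[Δ] = 0`
automatic); it is NOT mis-stated. The printed proof is the evident one — a slice disc in a small
ball `B⁴ ⊂ W` is a slice disc in `W ∖ B̊⁴` after turning the ball inside out — and that is what is
formalised here, for `W = S⁴`.

## Proof

Work in the unit sphere `S ⊆ V` of a real inner product space of dimension `n + 1` and fix a
pole `v ∈ S`. Mathlib's stereographic chart `σᵥ = stereographic' n v` (projection from `v`) has
target all of `ℝⁿ`, so `e := σᵥ⁻¹ : ℝⁿ → S` is a smooth embedding onto `S ∖ {v}` (tree lemma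
`Literature.Topology.FourManifolds.isSmoothEmbedding_symm_of_target_eq_univ`); this is the removed ball. In Mathlib's
normalisation `σᵥ⁻¹(x) = (‖x‖² + 4)⁻¹ • (4 w(x) + (‖x‖² − 4) v)` with `w` a linear isometry of `ℝⁿ`
onto `vᗮ` (`Literature.Topology.FourManifolds.coe_stereographic'_symm_apply`), and comparing coefficients gives the key identity
(`neg_stereographic'_symm_neg_four_smul`)

  `-σᵥ⁻¹(-4 • z) = σᵥ⁻¹(‖z‖⁻² • z)` for `z ≠ 0`:

the smooth injective immersion `Ψ(z) := -σᵥ⁻¹(-4 • z)` (homothety, chart inverse, antipodal map)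
restricts off the origin to `σᵥ⁻¹ ∘ ι` with `ι` the inversion in the unit sphere of `ℝⁿ`, and
`Ψ(0) = v ∉ σᵥ⁻¹(ℝⁿ)`. Hence `Ψ = σᵥ⁻¹` on the unit sphere and `Ψ` maps the open unit ball into
`S ∖ σᵥ⁻¹(𝔻ⁿ)`. For `n = 4`, `V = ℝ⁵`, `v = -a` (so that `σᵥ = chartAt a`) and a slice disc `f` of
`K` in `B⁴` (`Knot.IsSliceDisc`), the composite `Ψ ∘ f` is a slice disc for `K` in
`S⁴ ∖ σᵥ⁻¹(B̊⁴)` in the sense of `Knot.IsSliceDiscIn` (`Knot.IsSliceDisc.isSliceDiscIn_sphere`):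
smoothness, injectivity and injectivity of `mfderiv` pass to the composite because the
differential of a chart inverse is invertible (`OpenPartialHomeomorph.MDifferentiable`) and the
antipodal map is a smooth involution. Finally `S⁴ ≃ₕ S⁴`.

Only Mathlib's manifold library and the tree's stereographic bookkeeping
(`PalaisBallComplement.lean`: `stereoTangential`, `coe_stereographic'_symm_apply`,
`stereographic'_symm_ne`, `stereographic'_symm_zero`, `contMDiff_stereographic'_symm`) are used;
no named fact is assumed.

## References

* C. Manolescu, L. Piccirillo, J. Lond. Math. Soc. 108 (2023) 2001–2036, §2, after Def. 2.1
  [ManolescuPiccirillo2023].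
* M. Freedman, R. Gompf, S. Morrison, K. Walker, Quantum Topol. 1 (2010), §1
  [FreedmanGompfMorrisonWalker2010] (the notion `IsHomotopyBallSlice`).
-/

open scoped Manifold ContDiff Topology RealInnerProductSpace
open Function Set Metric Module

noncomputable section

namespace Literature.Topology.FourManifolds

/-! ### Turning the stereographic ball inside out -/

section Inversion

variable {V : Type*} [NormedAddCommGroup V] [InnerProductSpace ℝ V] {n : ℕ}
  [Fact (finrank ℝ V = n + 1)] (v : sphere (0 : V) 1)

/-- `σᵥ` belongs to the atlas of the sphere. [folklore] -/
theorem stereographic'_mem_atlas :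
    stereographic' n v ∈ atlas (EuclideanSpace ℝ (Fin n)) (sphere (0 : V) 1) :=
  ⟨v, rfl⟩

/-- The inverse stereographic projection `σᵥ⁻¹ : ℝⁿ → S` is injective. [folklore] -/
theorem stereographic'_symm_injective : Injective (stereographic' n v).symm := by
  rw [← Set.injOn_univ, ← stereographic'_target v]
  exact (stereographic' n v).symm.injOn

/-- **The round ball.** The inverse stereographic projection `σᵥ⁻¹ : ℝⁿ → S` is a smooth
embedding (`Manifold.IsSmoothEmbedding`; tree lemma `isSmoothEmbedding_symm_of_target_eq_univ`:
the inverse of a chart of the maximal atlas with full target). [folklore] -/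
theorem isSmoothEmbedding_stereographic'_symm :
    Manifold.IsSmoothEmbedding (𝓡 n) (𝓡 n) ∞ (stereographic' n v).symm :=
  isSmoothEmbedding_symm_of_target_eq_univ
    (IsManifold.subset_maximalAtlas (stereographic'_mem_atlas v)) (stereographic'_target v)

/-- The differential of `σᵥ⁻¹` is injective everywhere (it is the inverse of a chart).
[folklore] -/
theorem injective_mfderiv_stereographic'_symm (x : EuclideanSpace ℝ (Fin n)) :
    Injective (mfderiv (𝓡 n) (𝓡 n) (stereographic' n v).symm x) :=
  (mdifferentiable_of_mem_atlas (I := 𝓡 n) (stereographic'_mem_atlas v)).symm.mfderiv_injective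
    (by simp)

/-- **Key identity** (antipode after homothety = inversion, read in the chart `σᵥ`): for `z ≠ 0`
the antipode of `σᵥ⁻¹(-4 • z)` is `σᵥ⁻¹(‖z‖⁻² • z)`; by `coe_stereographic'_symm_apply` both are
`(4‖z‖² + 1)⁻¹ • (4 w(z) + (1 − 4‖z‖²) v)`. [folklore] -/
theorem neg_stereographic'_symm_neg_four_smul {z : EuclideanSpace ℝ (Fin n)} (hz : z ≠ 0) :
    -(stereographic' n v).symm ((-4 : ℝ) • z) =
      (stereographic' n v).symm ((‖z‖ ^ 2)⁻¹ • z) := by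
  apply Subtype.ext
  rw [coe_neg_sphere, coe_stereographic'_symm_apply, coe_stereographic'_symm_apply,
    stereoTangential_smul, stereoTangential_smul]
  have hs : (0 : ℝ) < ‖z‖ := norm_pos_iff.mpr hz
  simp only [norm_smul, norm_neg, norm_inv, norm_pow, Real.norm_eq_abs, abs_norm, smul_smul]
  match_scalars
  · field_simp
    ring
  · field_simp
    ring

/-- On the unit sphere of `ℝⁿ` the map `z ↦ -σᵥ⁻¹(-4 • z)` agrees with `σᵥ⁻¹` (the inversion
fixes the unit sphere pointwise). [folklore] -/
theorem neg_stereographic'_symm_neg_four_smul_of_norm_eq_one {z : EuclideanSpace ℝ (Fin n)}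
    (hz : ‖z‖ = 1) :
    -(stereographic' n v).symm ((-4 : ℝ) • z) = (stereographic' n v).symm z := by
  rw [neg_stereographic'_symm_neg_four_smul v (by rintro rfl; simp at hz), hz]
  simp

/-- The map `z ↦ -σᵥ⁻¹(-4 • z)` sends the origin to the pole `v` (`σᵥ⁻¹ 0 = -v`). [folklore] -/
theorem neg_stereographic'_symm_neg_four_smul_zero :
    -(stereographic' n v).symm ((-4 : ℝ) • (0 : EuclideanSpace ℝ (Fin n))) = v := by
  rw [smul_zero, stereographic'_symm_zero, neg_neg]

/-- The map `z ↦ -σᵥ⁻¹(-4 • z)` is injective. [folklore] -/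
theorem injective_neg_stereographic'_symm_neg_four_smul :
    Injective fun z : EuclideanSpace ℝ (Fin n) ↦ -(stereographic' n v).symm ((-4 : ℝ) • z) :=
  neg_injective.comp <| (stereographic'_symm_injective v).comp <|
    smul_right_injective (EuclideanSpace ℝ (Fin n)) (by norm_num)

/-- The homothety `z ↦ -4 • z` is smooth. [folklore] -/
theorem contDiff_neg_four_smul : ContDiff ℝ ∞ fun z : EuclideanSpace ℝ (Fin n) ↦ (-4 : ℝ) • z :=
  contDiff_id.const_smul (-4 : ℝ)

/-- The map `z ↦ -σᵥ⁻¹(-4 • z)` is smooth (`contMDiff_neg_sphere` for the antipodal map,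
`contMDiff_stereographic'_symm` for the chart inverse). [folklore] -/
theorem contMDiff_neg_stereographic'_symm_neg_four_smul :
    ContMDiff (𝓡 n) (𝓡 n) ∞
      fun z : EuclideanSpace ℝ (Fin n) ↦ -(stereographic' n v).symm ((-4 : ℝ) • z) :=
  contMDiff_neg_sphere.comp <|
    (contMDiff_stereographic'_symm v).comp contDiff_neg_four_smul.contMDiff

/-- `∞ ≠ 0` in `ℕ∞ω` (to extract differentiability from `C^∞`). [folklore] -/
theorem withTopENat_infty_ne_zero : (∞ : ℕ∞ω) ≠ 0 := by simp

/-- The composition of injective continuous linear maps is injective (`Function.Injective.comp`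
stated for `ContinuousLinearMap.comp`, with the structure arguments as unifiable implicits, so
that it applies verbatim to the chain rule `mfderiv (g ∘ f) x = (mfderiv g (f x)).comp (mfderiv f x)`
between Mathlib's type-tagged tangent spaces). [folklore] -/
theorem injective_continuousLinearMap_comp {R : Type*} {_ : Semiring R} {M₁ M₂ M₃ : Type*}
    {_ : TopologicalSpace M₁} {_ : AddCommMonoid M₁} {_ : Module R M₁}
    {_ : TopologicalSpace M₂} {_ : AddCommMonoid M₂} {_ : Module R M₂}
    {_ : TopologicalSpace M₃} {_ : AddCommMonoid M₃} {_ : Module R M₃}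
    {g : M₂ →L[R] M₃} {f : M₁ →L[R] M₂} (hg : Injective g) (hf : Injective f) :
    Injective (g.comp f) :=
  hg.comp hf

/-- The differential of the antipodal map of the sphere is injective at every point: the antipodal
map is a smooth involution, so by the chain rule its differential at `-p` is a left inverse of its
differential at `p`. [folklore] -/
theorem injective_mfderiv_neg_sphere (p : sphere (0 : V) 1) :
    Injective (mfderiv (𝓡 n) (𝓡 n) (fun x : sphere (0 : V) 1 ↦ -x) p) := by
  have hd : ∀ q : sphere (0 : V) 1, MDifferentiableAt (𝓡 n) (𝓡 n) (fun x : sphere (0 : V) 1 ↦ -x) q :=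
    fun q ↦ (contMDiff_neg_sphere (m := 1) q).mdifferentiableAt one_ne_zero
  have hcomp := mfderiv_comp p (hd (-p)) (hd p)
  have hid : ((fun x : sphere (0 : V) 1 ↦ -x) ∘ fun x : sphere (0 : V) 1 ↦ -x) = id := by
    ext x; simp
  rw [hid, mfderiv_id] at hcomp
  refine Function.LeftInverse.injective
    (g := mfderiv (𝓡 n) (𝓡 n) (fun x : sphere (0 : V) 1 ↦ -x) (-p)) fun w ↦ ?_
  have := congrArg (fun φ ↦ φ w) hcomp
  exact this.symm

/-- The map `z ↦ -σᵥ⁻¹(-4 • z)` is an immersion: its differential is injective everywhere (chain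
rule; the three factors `-4 • id`, `dσᵥ⁻¹` and `d(antipode)` are injective). [folklore] -/
theorem injective_mfderiv_neg_stereographic'_symm_neg_four_smul (z : EuclideanSpace ℝ (Fin n)) :
    Injective (mfderiv (𝓡 n) (𝓡 n)
      (fun z : EuclideanSpace ℝ (Fin n) ↦ -(stereographic' n v).symm ((-4 : ℝ) • z)) z) := by
  have h1 : MDifferentiableAt (𝓡 n) (𝓡 n) (fun u : EuclideanSpace ℝ (Fin n) ↦ (-4 : ℝ) • u) z :=
    (contDiff_neg_four_smul.contMDiff z).mdifferentiableAt withTopENat_infty_ne_zero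
  have h2 : MDifferentiableAt (𝓡 n) (𝓡 n) (stereographic' n v).symm ((-4 : ℝ) • z) :=
    (contMDiff_stereographic'_symm v ((-4 : ℝ) • z)).mdifferentiableAt withTopENat_infty_ne_zero
  have h3 : MDifferentiableAt (𝓡 n) (𝓡 n) (fun x : sphere (0 : V) 1 ↦ -x)
      ((stereographic' n v).symm ((-4 : ℝ) • z)) :=
    (contMDiff_neg_sphere (m := 1) _).mdifferentiableAt one_ne_zero
  have h4 : Injective (mfderiv (𝓡 n) (𝓡 n) (fun u : EuclideanSpace ℝ (Fin n) ↦ (-4 : ℝ) • u) z) := by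
    have hL : HasMFDerivAt (𝓡 n) (𝓡 n) (fun u : EuclideanSpace ℝ (Fin n) ↦ (-4 : ℝ) • u) z
        ((-4 : ℝ) • ContinuousLinearMap.id ℝ (EuclideanSpace ℝ (Fin n))) :=
      hasMFDerivAt_iff_hasFDerivAt.mpr ((hasFDerivAt_id z).const_smul (-4 : ℝ))
    rw [hL.mfderiv]
    intro u w huw
    have huw' : (-4 : ℝ) • (u : EuclideanSpace ℝ (Fin n)) = (-4 : ℝ) • (w : EuclideanSpace ℝ (Fin n)) :=
      huw
    exact smul_right_injective (EuclideanSpace ℝ (Fin n)) (by norm_num : (-4 : ℝ) ≠ 0) huw'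
  have e1 : (fun z : EuclideanSpace ℝ (Fin n) ↦ -(stereographic' n v).symm ((-4 : ℝ) • z)) =
      (fun x : sphere (0 : V) 1 ↦ -x) ∘
        ((stereographic' n v).symm ∘ fun u : EuclideanSpace ℝ (Fin n) ↦ (-4 : ℝ) • u) :=
    rfl
  rw [e1, mfderiv_comp z h3 (h2.comp z h1), mfderiv_comp z h2 h1]
  exact injective_continuousLinearMap_comp (injective_mfderiv_neg_sphere _)
    (injective_continuousLinearMap_comp (injective_mfderiv_stereographic'_symm v _) h4)

/-- The map `z ↦ -σᵥ⁻¹(-4 • z)` sends the open unit ball off the round closed ball `σᵥ⁻¹(𝔻ⁿ)`: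
off the origin it is `σᵥ⁻¹ ∘ ι` with `‖ι z‖ = ‖z‖⁻¹ > 1` and `σᵥ⁻¹` is injective, and the origin
goes to the pole `v ∉ σᵥ⁻¹(ℝⁿ)`. [folklore] -/
theorem neg_stereographic'_symm_neg_four_smul_notMem {z : EuclideanSpace ℝ (Fin n)} (hz : ‖z‖ < 1) :
    -(stereographic' n v).symm ((-4 : ℝ) • z) ∉
      (stereographic' n v).symm '' closedBall (0 : EuclideanSpace ℝ (Fin n)) 1 := by
  rintro ⟨u, hu, hu'⟩
  rw [mem_closedBall_zero_iff] at hu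
  by_cases h0 : z = 0
  · rw [h0, neg_stereographic'_symm_neg_four_smul_zero] at hu'
    exact stereographic'_symm_ne v u hu'
  · rw [neg_stereographic'_symm_neg_four_smul v h0] at hu'
    have hu_eq := stereographic'_symm_injective v hu'
    have hpos : 0 < ‖z‖ := norm_pos_iff.mpr h0
    have hnorm : ‖u‖ = ‖z‖⁻¹ := by
      rw [hu_eq, norm_smul, norm_inv, norm_pow, norm_norm]
      field_simp
    rw [hnorm, inv_le_one₀ hpos] at hu
    linarith

end Inversion

/-! ### The slice disc in `S⁴ ∖ B̊⁴` -/

namespace Knot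

/-- Local notation: `𝔼 n` is the model Euclidean space `EuclideanSpace ℝ (Fin n)`. -/
local notation "𝔼 " n:arg => EuclideanSpace ℝ (Fin n)

/-- Local notation: `𝕊 n` is the unit sphere in `EuclideanSpace ℝ (Fin (n + 1))`. -/
local notation "𝕊 " n:arg => (Metric.sphere (0 : EuclideanSpace ℝ (Fin (n + 1))) 1)

/-- `ℝ⁵` has dimension `4 + 1`: the `Fact` under which Mathlib's `stereographic' 4` charts of
`S⁴ ⊆ ℝ⁵` are stated (Mathlib installs it only inside the `ChartedSpace` instance of `𝕊 4`, whose
`chartAt a` is `stereographic' 4 (-a)` by definition); a local instance in this section, as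
Mathlib does for the circle. [folklore] -/
theorem fact_finrank_euclideanSpace_four_add_one :
    Fact (finrank ℝ (EuclideanSpace ℝ (Fin (4 + 1))) = 4 + 1) :=
  ⟨finrank_euclideanSpace_fin⟩

section SliceDisc

attribute [local instance] fact_finrank_euclideanSpace_four_add_one

/-- **Pushing a slice disc into `S⁴ ∖ B̊⁴`.** If `f` is a slice disc for `K` in `B⁴`
(`Knot.IsSliceDisc`), then `x ↦ -c⁻¹(-4 • f x)` is a slice disc for `K` in `S⁴ ∖ c⁻¹(B̊⁴)` in the
sense of `Knot.IsSliceDiscIn`, where `c = chartAt a = stereographic' 4 (-a)` is the stereographic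
chart of `S⁴` at any point `a` and `c⁻¹ : ℝ⁴ → S⁴` the round ball it defines: off the origin the
new disc is `c⁻¹ ∘ ι ∘ f` with `ι` the inversion in `S³`, which fixes `K ⊂ S³` and throws the
open unit ball off `c⁻¹(𝔻⁴)`, and `f x = 0` goes to the pole `-a ∉ c⁻¹(ℝ⁴)`; neatness of `f` is
not needed. This is the remark "if a knot is slice in the usual sense, then it is H-slice in any
`W`" for `W = S⁴`. [cite: ManolescuPiccirillo2023, §2 (remark after Def. 2.1)] -/
theorem IsSliceDisc.isSliceDiscIn_sphere (a : 𝕊 4) {K : Knot} {f : 𝔼 2 → 𝔼 4}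
    (hf : K.IsSliceDisc f) :
    K.IsSliceDiscIn (𝕊 4) (chartAt (𝔼 4) a).symm
      fun x ↦ -(chartAt (𝔼 4) a).symm ((-4 : ℝ) • f x) := by
  obtain ⟨hf_smooth, hf_inj, hf_der, hf_in, -, hf_bd⟩ := hf
  have hc : chartAt (𝔼 4) a = stereographic' 4 (-a) := rfl
  have hcomp : (fun x ↦ -(stereographic' 4 (-a)).symm ((-4 : ℝ) • f x)) =
      (fun w : 𝔼 4 ↦ -(stereographic' 4 (-a)).symm ((-4 : ℝ) • w)) ∘ f := rfl
  rw [hc]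
  refine ⟨isSmoothEmbedding_stereographic'_symm (-a),
    hcomp ▸ (contMDiff_neg_stereographic'_symm_neg_four_smul (-a)).comp hf_smooth.contMDiff,
    hcomp ▸ (injective_neg_stereographic'_symm_neg_four_smul (-a)).comp_injOn hf_inj,
    fun x hx ↦ ?_, fun x hx ↦ neg_stereographic'_symm_neg_four_smul_notMem (-a) (hf_in x hx),
    fun x ↦ ?_⟩
  · have h1 : MDifferentiableAt (𝓡 2) (𝓡 4) f x :=
      (hf_smooth.contMDiff x).mdifferentiableAt withTopENat_infty_ne_zero
    have h2 : MDifferentiableAt (𝓡 4) (𝓡 4)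
        (fun w : 𝔼 4 ↦ -(stereographic' 4 (-a)).symm ((-4 : ℝ) • w)) (f x) :=
      (contMDiff_neg_stereographic'_symm_neg_four_smul (-a) (f x)).mdifferentiableAt
        withTopENat_infty_ne_zero
    rw [hcomp, mfderiv_comp x h2 h1]
    refine injective_continuousLinearMap_comp
      (injective_mfderiv_neg_stereographic'_symm_neg_four_smul (-a) (f x)) ?_
    rw [mfderiv_eq_fderiv]
    exact hf_der x hx
  · simp only [hf_bd x]
    exact neg_stereographic'_symm_neg_four_smul_of_norm_eq_one (-a) (by simp)

end SliceDisc

/-- **Slice knots are slice in a homotopy ball**: discharge of the named fact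
`Knot.IsSmoothlySlice.isHomotopyBallSlice`, with `Σ = S⁴` (homotopy equivalent to itself by
`HomotopyEquiv.refl`), the removed ball the inverse stereographic chart `(chartAt a)⁻¹ : ℝ⁴ → S⁴`
at the point `a = (1, 0, 0, 0, 0)`, and the slice disc pushed into the complementary ball by
`Knot.IsSliceDisc.isSliceDiscIn_sphere`. Manolescu–Piccirillo: "if a knot is slice in the usual
sense, then it is H-slice in any `W`" (here `W = S⁴`).
[cite: ManolescuPiccirillo2023, §2 (remark after Def. 2.1)] -/
theorem IsSmoothlySlice.isHomotopyBallSlice_holds : IsSmoothlySlice.isHomotopyBallSlice := by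
  intro K hK
  obtain ⟨f, hf⟩ := hK
  exact (hf.isSliceDiscIn_sphere ⟨EuclideanSpace.single 0 1, by simp⟩).isHomotopyBallSlice
    ⟨ContinuousMap.HomotopyEquiv.refl (𝕊 4)⟩

end Knot

end Literature.Topology.FourManifolds

end
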